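import Mathlib.GroupTheory.FreeGroup.Basic
import Mathlib.GroupTheory.SemidirectProduct
import Mathlib.GroupTheory.FiniteIndexNormalSubgroup
import Mathlib.GroupTheory.ResiduallyFinite
import Mathlib.GroupTheory.QuotientGroup.Basic
import Mathlib.Data.Finsupp.SMul
import Mathlib.Data.ZMod.Basic
import Mathlib.Algebra.Group.End
import Mathlib.Algebra.GroupWithZero.Action.Basic
import Mathlib.Algebra.Group.TypeTags.Finite
import Mathlib.Tactic.Group
import HarnessLib

/-!
# Mod-2 Fox calculus in lamplighter-type quotients of a free group

Topic `Literature/GroupTheory/CombinatorialGroupTheory`.  Toolkit for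
`FreeGroupProfiniteNormalizer.lean` (the free group is its own normalizer in its profinite
completion, [SemiAnbd] Lem. 6.1 (i)).  For a group `X` we consider the "lamplighter-type" semidirect
product `𝕎[X] = (X →₀ ZMod 2) ⋊ X` (`X` acting on finitely supported `ZMod 2`-valued functions by
left translation, Mathlib's `Finsupp.comapDistribMulAction`), the homomorphisms `𝕎[X] → 𝕎[Y]`
induced by `π : X →* Y` (push-forward `Finsupp.mapDomain π` on the first factor), and, for a free
group `F = FreeGroup ι` with a distinguished generator `x_{i₀}`, the homomorphism
`Ψ[i₀] : F → 𝕎[F]`, `x_{i₀} ↦ (δ_1, x_{i₀})`, `x_i ↦ (0, x_i)` (`i ≠ i₀`), whose first component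
is the Fox derivative `∂/∂x_{i₀}` with coefficients in `ZMod 2`.  We record: the conjugation
formula in `𝕎[X]`, the "coset-sum" functional `ν ↦ Σ_{s : P s} ν s` and its invariance properties,
two finite-intersection lemmas on finite-index normal subgroups of a residually finite group, and
the components of `Ψ[i₀]` and of its push-forwards.

Everything here is elementary bookkeeping over Mathlib; no new definitions are introduced (the
objects above are local notation, repeated verbatim in the consumer file). [cite: MochizukiSemiAnbd2006, Lem 6.1(i) p.69]
-/

namespace Literature.GroupTheory.CombinatorialGroupTheory

open Multiplicative Finsupp

open scoped Classical

noncomputable section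

attribute [local instance] Finsupp.comapDistribMulAction

set_option quotPrecheck false

universe u

/-- Local notation: the left-translation action of `X` on `X →₀ ZMod 2`, as a homomorphism
`X →* MulAut (Multiplicative (X →₀ ZMod 2))`. -/
local notation "ρ[" X "]" =>
  (MonoidHom.comp (MulEquiv.toMonoidHom (MulEquiv.symm (MulAutMultiplicative (X →₀ ZMod 2))))
    (DistribMulAction.toAddAut X (X →₀ ZMod 2)))

/-- Local notation: the lamplighter-type product `(X →₀ ZMod 2) ⋊ X`. -/
local notation "𝕎[" X "]" => (Multiplicative (X →₀ ZMod 2) ⋊[ρ[X]] X)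

section Wreath

variable {X : Type u} [Group X] {Y : Type u} [Group Y]

/-- The action homomorphism unfolds to the translation action. [cite: MochizukiSemiAnbd2006, Lem 6.1(i) p.69] -/
theorem rho_apply_ofAdd (q : X) (θ : X →₀ ZMod 2) :
    (ρ[X] q) (ofAdd θ) = ofAdd (q • θ) := rfl

/-- The action homomorphism unfolds to the translation action (additive form). [cite: MochizukiSemiAnbd2006, Lem 6.1(i) p.69] -/
theorem toAdd_rho_apply (q : X) (m : Multiplicative (X →₀ ZMod 2)) :
    toAdd ((ρ[X] q) m) = q • toAdd m := rfl

/-- Translation of a point mass: `q • δ_t = δ_{q t}`. [cite: MochizukiSemiAnbd2006, Lem 6.1(i) p.69] -/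
theorem smul_single_one (q t : X) :
    q • (single t (1 : ZMod 2)) = single (q * t) 1 := by
  rw [comapSMul_single]; rfl

omit [Group X] in
/-- In `X →₀ ZMod 2` every element is its own negative. [cite: MochizukiSemiAnbd2006, Lem 6.1(i) p.69] -/
theorem finsupp_zmod2_neg_eq (θ : X →₀ ZMod 2) : -θ = θ := by
  ext s; simp [ZMod.neg_eq_self_mod_two]

/-- The conjugation formula in `𝕎[X]`: the translation component of `a b a⁻¹` is
`μ_a + a_X • μ_b - (a_X b_X a_X⁻¹) • μ_a`. [cite: MochizukiSemiAnbd2006, Lem 6.1(i) p.69] -/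
theorem toAdd_conj_left (a b : 𝕎[X]) :
    toAdd (a * b * a⁻¹).left =
      toAdd a.left + a.right • toAdd b.left - (a.right * b.right * a.right⁻¹) • toAdd a.left := by
  have h1 : (a * b * a⁻¹).left =
      a.left * (ρ[X] a.right) b.left * (ρ[X] (a.right * b.right * a.right⁻¹)) a.left⁻¹ := by
    simp only [SemidirectProduct.mul_left, SemidirectProduct.mul_right,
      SemidirectProduct.inv_left, map_mul, MulAut.mul_apply]
  rw [h1, toAdd_mul, toAdd_mul, toAdd_rho_apply, toAdd_rho_apply, toAdd_inv, smul_neg,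
    sub_eq_add_neg]

/-- Push-forward of translation modules along a homomorphism `π : X → Y` is equivariant; this is the
compatibility needed for `SemidirectProduct.map`. [cite: MochizukiSemiAnbd2006, Lem 6.1(i) p.69] -/
theorem mapDomain_equivariant (π : X →* Y) (x : X) :
    (AddMonoidHom.toMultiplicative (mapDomain.addMonoidHom π)).comp (ρ[X] x).toMonoidHom =
      (ρ[Y] (π x)).toMonoidHom.comp (AddMonoidHom.toMultiplicative (mapDomain.addMonoidHom π)) := by
  refine MonoidHom.ext fun m => ?_
  change mapDomain π (x • toAdd m) = π x • mapDomain π (toAdd m)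
  rw [comapSMul_def, comapSMul_def, ← mapDomain_comp, ← mapDomain_comp]
  congr 1
  funext s
  simp [smul_eq_mul]

/-! ### The coset-sum functional `ν ↦ Σ_{P s} ν s` -/

omit [Group X] in
/-- Additivity of the coset-sum functional. [cite: MochizukiSemiAnbd2006, Lem 6.1(i) p.69] -/
theorem S_add (P : X → Prop) (ν ν' : X →₀ ZMod 2) :
    Finsupp.sum (ν + ν') (fun s b => if P s then b else 0) =
      Finsupp.sum ν (fun s b => if P s then b else 0) +
        Finsupp.sum ν' (fun s b => if P s then b else 0) := by
  refine sum_add_index' (fun s => ?_) (fun s b₁ b₂ => ?_)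
  · by_cases h : P s <;> simp [h]
  · by_cases h : P s <;> simp [h]

omit [Group X] in
/-- The functional on a negative. [cite: MochizukiSemiAnbd2006, Lem 6.1(i) p.69] -/
theorem S_neg (P : X → Prop) (ν : X →₀ ZMod 2) :
    Finsupp.sum (-ν) (fun s b => if P s then b else 0) =
      Finsupp.sum ν (fun s b => if P s then b else 0) := by
  rw [finsupp_zmod2_neg_eq]

omit [Group X] in
/-- The functional on a point mass. [cite: MochizukiSemiAnbd2006, Lem 6.1(i) p.69] -/
theorem S_single (P : X → Prop) (t : X) (b : ZMod 2) :
    Finsupp.sum (single t b) (fun s b => if P s then b else 0) = if P t then b else 0 := by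
  rw [sum_single_index]
  by_cases h : P t <;> simp [h]

/-- Invariance of the coset-sum functional under a translation preserving `P`. [cite: MochizukiSemiAnbd2006, Lem 6.1(i) p.69] -/
theorem S_smul (P : X → Prop) (q : X) (hP : ∀ s, P (q * s) ↔ P s) (ν : X →₀ ZMod 2) :
    Finsupp.sum (q • ν) (fun s b => if P s then b else 0) =
      Finsupp.sum ν (fun s b => if P s then b else 0) := by
  rw [comapSMul_def, sum_mapDomain_index (fun _ => by simp)
    (fun s b₁ b₂ => by by_cases h : P s <;> simp [h])]
  refine Finsupp.sum_congr fun s _ => ?_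
  simp only [smul_eq_mul, hP]

omit [Group X] [Group Y] in
/-- The functional of a push-forward. [cite: MochizukiSemiAnbd2006, Lem 6.1(i) p.69] -/
theorem S_mapDomain (P : Y → Prop) (π : X → Y) (θ : X →₀ ZMod 2) :
    Finsupp.sum (mapDomain π θ) (fun s b => if P s then b else 0) =
      Finsupp.sum θ (fun f b => if P (π f) then b else 0) :=
  sum_mapDomain_index (fun _ => by simp) (fun s b₁ b₂ => by by_cases h : P s <;> simp [h])

omit [Group X] [Group Y] in
/-- If the functional of a push-forward is non-zero, some support point maps into `P`. [cite: MochizukiSemiAnbd2006, Lem 6.1(i) p.69] -/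
theorem exists_mem_support_of_sum_ne_zero (P : Y → Prop) (π : X → Y) (θ : X →₀ ZMod 2)
    (h : Finsupp.sum θ (fun f b => if P (π f) then b else 0) ≠ 0) :
    ∃ f ∈ θ.support, P (π f) := by
  by_contra hcon
  push Not at hcon
  exact h (Finset.sum_eq_zero fun f hf => if_neg (hcon f hf))

end Wreath

/-! ### Finite sets and finite-index normal subgroups of a residually finite group -/

section Residual

variable {G : Type u} [Group G]

/-- A finite family of finite-index normal subgroups has a common lower bound. [cite: MochizukiSemiAnbd2006, Lem 6.1(i) p.69] -/
theorem exists_le_forall_of_finset (s : Finset G) (Nf : G → FiniteIndexNormalSubgroup G) :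
    ∃ N₀ : FiniteIndexNormalSubgroup G, ∀ f ∈ s, N₀ ≤ Nf f := by
  induction s using Finset.induction_on with
  | empty => exact ⟨{ toSubgroup := ⊤ }, fun f hf => absurd hf (by simp)⟩
  | insert a s _ ih =>
    obtain ⟨N₁, hN₁⟩ := ih
    refine ⟨N₁ ⊓ Nf a, fun f hf => ?_⟩
    rcases Finset.mem_insert.mp hf with rfl | hf
    · exact inf_le_right
    · exact le_trans inf_le_left (hN₁ f hf)

/-- In a residually finite group, finitely many non-trivial elements are simultaneously excluded by
one finite-index normal subgroup. [cite: MochizukiSemiAnbd2006, Lem 6.1(i) p.69] -/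
theorem exists_forall_notMem_of_finset [Group.ResiduallyFinite G] (D : Finset G)
    (hD : ∀ d ∈ D, d ≠ 1) : ∃ N : FiniteIndexNormalSubgroup G, ∀ d ∈ D, d ∉ N := by
  induction D using Finset.induction_on with
  | empty => exact ⟨{ toSubgroup := ⊤ }, fun d hd => absurd hd (by simp)⟩
  | insert a s _ ih =>
    obtain ⟨N₁, hN₁⟩ := ih fun d hd => hD d (Finset.mem_insert_of_mem hd)
    obtain ⟨M, hM⟩ := Group.exists_finiteIndexNormalSubgroup_notMem a
      (hD a (Finset.mem_insert_self a s))
    refine ⟨N₁ ⊓ M, fun d hd => ?_⟩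
    rcases Finset.mem_insert.mp hd with rfl | hd
    · exact fun h => hM (inf_le_right (a := N₁) h)
    · exact fun h => hN₁ d hd (inf_le_left (b := M) h)

/-- In a residually finite group, some finite quotient is injective on a given finite set.
[cite: MochizukiSemiAnbd2006, Lem 6.1(i) p.69] -/
theorem exists_injOn_mk_of_finset [Group.ResiduallyFinite G] (s : Finset G) :
    ∃ N : FiniteIndexNormalSubgroup G,
      Set.InjOn (QuotientGroup.mk' N.toSubgroup) (s : Set G) := by
  let D : Finset G := ((s ×ˢ s).image fun p => p.1⁻¹ * p.2).filter fun d => d ≠ 1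
  obtain ⟨N, hN⟩ := exists_forall_notMem_of_finset D (fun d hd => (Finset.mem_filter.mp hd).2)
  refine ⟨N, fun f hf f' hf' hff' => ?_⟩
  by_contra hne
  have hmem : f⁻¹ * f' ∈ D := by
    refine Finset.mem_filter.mpr ⟨Finset.mem_image.mpr ⟨(f, f'), Finset.mem_product.mpr ⟨hf, hf'⟩,
      rfl⟩, fun h => hne ?_⟩
    rw [← mul_right_inj f⁻¹, inv_mul_cancel, h]
  exact hN _ hmem (QuotientGroup.eq.mp hff')

end Residual

/-! ### Induced maps `𝕎[X] → 𝕎[Y]` and the Fox derivative homomorphism `Ψ[i₀]` -/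

/-- Local notation: the homomorphism `𝕎[X] → 𝕎[Y]` induced by `π : X →* Y`. -/
local notation "𝕎map[" π "]" =>
  (SemidirectProduct.map (AddMonoidHom.toMultiplicative (mapDomain.addMonoidHom π)) π
    (mapDomain_equivariant π))

section Free

variable {X : Type} [Group X] {Y : Type} [Group Y]

/-- First component of `𝕎map`. [cite: MochizukiSemiAnbd2006, Lem 6.1(i) p.69] -/
theorem toAdd_map_left (π : X →* Y) (a : 𝕎[X]) :
    toAdd ((𝕎map[π]) a).left = mapDomain π (toAdd a.left) := rfl

/-- Second component of `𝕎map`. [cite: MochizukiSemiAnbd2006, Lem 6.1(i) p.69] -/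
theorem map_right' (π : X →* Y) (a : 𝕎[X]) : ((𝕎map[π]) a).right = π a.right := rfl

variable {ι : Type} [DecidableEq ι]

/-- Local notation: `Ψ[i₀] : F →* 𝕎[F]`, `x_{i₀} ↦ (δ_1, x_{i₀})`, `x_i ↦ (0, x_i)` (`i ≠ i₀`); its
first component is the mod-2 Fox derivative `∂/∂x_{i₀}`. -/
local notation "Ψ[" i₀ "]" =>
  (FreeGroup.lift (fun i => (⟨ofAdd (if i = i₀ then single (1 : FreeGroup ι) (1 : ZMod 2) else 0),
    FreeGroup.of i⟩ : 𝕎[FreeGroup ι])))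

/-- The second component of `Ψ[i₀]` is the identity. [cite: MochizukiSemiAnbd2006, Lem 6.1(i) p.69] -/
theorem right_Psi (i₀ : ι) (u : FreeGroup ι) : (Ψ[i₀] u).right = u := by
  have h : SemidirectProduct.rightHom.comp Ψ[i₀] = MonoidHom.id _ :=
    FreeGroup.ext_hom _ _ fun i => by
      rw [MonoidHom.comp_apply, FreeGroup.lift_apply_of]; rfl
  exact DFunLike.congr_fun h u

/-- `Ψ[i₀]` on a generator other than `x_{i₀}`. [cite: MochizukiSemiAnbd2006, Lem 6.1(i) p.69] -/
theorem Psi_of_ne (i₀ : ι) {i : ι} (h : i ≠ i₀) :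
    Ψ[i₀] (FreeGroup.of i) = SemidirectProduct.inr (FreeGroup.of i) := by
  rw [FreeGroup.lift_apply_of, if_neg h, ofAdd_zero]; rfl

/-- `Ψ[i₀]` on a power of a generator other than `x_{i₀}`. [cite: MochizukiSemiAnbd2006, Lem 6.1(i) p.69] -/
theorem Psi_zpow_of_ne (i₀ : ι) {i : ι} (h : i ≠ i₀) (k : ℤ) :
    Ψ[i₀] (FreeGroup.of i ^ k) = SemidirectProduct.inr (FreeGroup.of i ^ k) := by
  rw [map_zpow, Psi_of_ne i₀ h, ← map_zpow]

/-- The Fox derivative of the distinguished generator is `δ_1`. [cite: MochizukiSemiAnbd2006, Lem 6.1(i) p.69] -/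
theorem toAdd_left_Psi_self (i₀ : ι) :
    toAdd (Ψ[i₀] (FreeGroup.of i₀)).left = single 1 1 := by
  rw [FreeGroup.lift_apply_of, if_pos rfl]; rfl

/-- Second component of `𝕎map[π] ∘ Ψ[i₀]`. [cite: MochizukiSemiAnbd2006, Lem 6.1(i) p.69] -/
theorem psi_right (i₀ : ι) (π : FreeGroup ι →* X) (u : FreeGroup ι) :
    (((𝕎map[π]).comp Ψ[i₀]) u).right = π u := by
  rw [MonoidHom.comp_apply, map_right', right_Psi]

/-- First component of `𝕎map[π] ∘ Ψ[i₀]`: the push-forward of the Fox derivative. [cite: MochizukiSemiAnbd2006, Lem 6.1(i) p.69] -/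
theorem psi_left (i₀ : ι) (π : FreeGroup ι →* X) (u : FreeGroup ι) :
    toAdd ((((𝕎map[π]).comp Ψ[i₀]) u).left) = mapDomain π (toAdd (Ψ[i₀] u).left) := rfl

/-! ### The two algebraic cores of the normalizer argument -/

/-- **Core of step B0.** If, in `𝕎[X]` over `π : F → X`, the image of `w ∈ F` is the conjugate of
the image of the generator `x_{i₀}` by an element `a`, then some `f` in the support of the Fox
derivative `∂w/∂x_{i₀}` satisfies `(π f)⁻¹ a_X ∈ ⟨π x_{i₀}⟩`.  (Apply the coset-sum functional over
the coset `a_X ⟨π x_{i₀}⟩` to the first components.) [cite: MochizukiSemiAnbd2006, Lem 6.1(i) p.69] -/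
theorem core_B0 (i₀ : ι) (π : FreeGroup ι →* X) (a : 𝕎[X]) (w : FreeGroup ι)
    (hw : ((𝕎map[π]).comp Ψ[i₀]) w = a * ((𝕎map[π]).comp Ψ[i₀]) (FreeGroup.of i₀) * a⁻¹) :
    ∃ f ∈ (toAdd (Ψ[i₀] w).left).support,
      (π f)⁻¹ * a.right ∈ Subgroup.zpowers (π (FreeGroup.of i₀)) := by
  have key := congrArg (fun z => toAdd z.left) hw
  simp only at key
  rw [toAdd_conj_left, psi_left, psi_left, psi_right, toAdd_left_Psi_self, mapDomain_single,
    map_one, smul_single_one, mul_one] at key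
  -- the coset-sum functional for `P s :↔ s⁻¹ a_X ∈ ⟨π x_{i₀}⟩`
  let P : X → Prop := fun s => s⁻¹ * a.right ∈ Subgroup.zpowers (π (FreeGroup.of i₀))
  have hPinv : ∀ s, P (a.right * π (FreeGroup.of i₀) * a.right⁻¹ * s) ↔ P s := by
    intro s
    change (a.right * π (FreeGroup.of i₀) * a.right⁻¹ * s)⁻¹ * a.right ∈
        Subgroup.zpowers (π (FreeGroup.of i₀)) ↔ s⁻¹ * a.right ∈ Subgroup.zpowers (π (FreeGroup.of i₀))
    rw [show (a.right * π (FreeGroup.of i₀) * a.right⁻¹ * s)⁻¹ * a.right =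
      s⁻¹ * a.right * (π (FreeGroup.of i₀))⁻¹ by group]
    exact Subgroup.mul_mem_cancel_right _ (Subgroup.inv_mem _ (Subgroup.mem_zpowers _))
  have hPa : P a.right := by
    change a.right⁻¹ * a.right ∈ Subgroup.zpowers (π (FreeGroup.of i₀))
    rw [inv_mul_cancel]
    exact Subgroup.one_mem _
  have hS := congrArg (fun ν => Finsupp.sum ν (fun s b => if P s then b else 0)) key
  rw [S_mapDomain, sub_eq_add_neg, S_add, S_add, S_neg, S_smul P _ hPinv, S_single,
    if_pos hPa] at hS
  have hne : Finsupp.sum (toAdd (Ψ[i₀] w).left) (fun f b => if P (π f) then b else 0) ≠ 0 := by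
    rw [hS]
    have : ∀ x : ZMod 2, x + 1 + x ≠ 0 := by decide
    exact this _
  exact exists_mem_support_of_sum_ne_zero P _ _ hne

/-- **Core of step B3.** If, in `𝕎[X]` over `π : F → X`, the image of `v ∈ F` is the conjugate of
the image of the generator `x_j` by `(0, c)`, then the push-forward of `∂v/∂x_j` is the point mass
at `c`. [cite: MochizukiSemiAnbd2006, Lem 6.1(i) p.69] -/
theorem core_B3 (j : ι) (π : FreeGroup ι →* X) (c : X) (v : FreeGroup ι)
    (hv : ((𝕎map[π]).comp Ψ[j]) v = SemidirectProduct.inr c *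
      ((𝕎map[π]).comp Ψ[j]) (FreeGroup.of j) * (SemidirectProduct.inr c)⁻¹) :
    mapDomain π (toAdd (Ψ[j] v).left) = single c 1 := by
  have key := congrArg (fun z => toAdd z.left) hv
  simp only at key
  rw [toAdd_conj_left, SemidirectProduct.left_inr, SemidirectProduct.right_inr, toAdd_one,
    smul_zero, sub_zero, zero_add, psi_left, psi_left, toAdd_left_Psi_self, mapDomain_single,
    map_one, smul_single_one, mul_one] at key
  exact key

end Free

end

end Literature.GroupTheory.CombinatorialGroupTheory
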